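import Summits.BirchSwinnertonDyer.BirchSwinnertonDyer.Theorems.SylvesterTwoHeegnerIndexCMFlipLevelPairPrep
import Summits.BirchSwinnertonDyer.Rank1Residual.X11b.KolyvaginRingClassCyclic
import Summits.BirchSwinnertonDyer.Rank1Residual.X11b.KolyvaginRingClassCardinality
import HarnessLib

/-!
# The COUPLED Cassels–Tate telescope, XXXIV: COHERENT generators of the `G_q` along HSY's tower — one inertia
# element `τ_q ∈ Γ_K` per prime generates `G_q = Gal(K[qm]/K[m])` at EVERY level `qm`, `q ∤ m` (RESIDUE c v3
# (T-L1): the per-level DATA of the class term, made compatible across the FLIP pairs `(ℓm, m)`)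

Crux `UpperOffV0HSYPlus` (stmt-BirchSwinnertonDyer-19804).  The (T-L1) class term `c_X(n)` is built from
`D_n y_n`, `D_n = ∏_{q ∣ n} D_{σ_q}`; the FLIP at `(ℓm, m)` ((T9b)) compares `c(ℓm)` (built at the level
`9p(ℓm)`) with the class of `D_m^{(ℓm)}(incl y_m)`, which is `c(m)` (built at the level `9pm`) only if the
generators chosen at the two levels are COMPATIBLE along `K[9pm] ⊆ K[9p(ℓm)]`.  Design of record (STATUS
15:51Z): choose once per prime `q` an inertia element `τ_q ∈ I(𝔔_q) ⊂ Γ_K` restricting to a generator `σ₁` of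
`Gal(K[qd]/K[d])` at ONE level `qd` (k-ty1 #17b `exists_mem_inertia_generator_and_forall_smul_eq_pow_smul`);
this file proves that at EVERY level `qm` with `q ∤ m`, `K[qd] ⊆ K[qm]` (embedded coherently), the restriction
`σ` of `τ_q` (`τ_q ∘ emb = emb ∘ σ`, `exists_algEquiv_comp_eq`) GENERATES `G_q = ringClassGalOver ι (qm) m`:
`σ ∈ G_q` because `τ_q` fixes `K[m]` (unramified at `q`: #17b `apply_emb_eq_self_of_mem_inertia_of_mem_ringClassField`),
and `⟨σ⟩ = G_q` by counting — `#G_q = q + 1` (x11b3 `card_ringClassGalOver_div_eq_succ`) while `σ^k = 1` forces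
`σ₁^k = 1` through the injective inclusion, so `q + 1 = orderOf σ₁ ∣ orderOf σ`.  The restrictions at two
levels `qm ⊆ qm'` are then automatically compatible with the inclusion (`apply_inclusion_eq_of_restrict`).
* `apply_inclusion_eq_of_restrict` — `σ (incl x) = incl (σ₁ x)` for two restrictions of the same `τ`;
* ★ `zpowers_eq_ringClassGalOver_of_mem_inertia` — `Subgroup.zpowers σ = ringClassGalOver ι (q * m) m`.
Theorems only (no definition / named fact / instance / notation); nothing asserted on 19804; no stub closed;
X12.CMAtTwo NOT proved; BSD not claimed for any curve.  Sources: [GrossLMS1991] §3 (p. 238–240: `G_ℓ` cyclic of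
order `ℓ+1`, inertia at `λ`); [McCallumLMS1991] §4 (p. 304); [Cox2013] §9.A.  `lean search 'zpowers_eq_ringClassGalOver_of'` → x11b3's
existence forms only.
-/

set_option linter.dupNamespace false -- Summits modules are `Summit.<Summit>.<Problem>…` by design
set_option autoImplicit false

noncomputable section

open scoped Classical

namespace Summit.BirchSwinnertonDyer.BirchSwinnertonDyer.Theorems.SylvesterTwoCMFlip

open Field NumberField IsDedekindDomain
open Literature.NumberTheory.EllipticCurves Literature.NumberTheory.GaloisRepresentations
  Literature.NumberTheory.EllipticCurves.RingClassField
  Summit.BirchSwinnertonDyer.Rank1Residual.X11b.RingClassTower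
  Summit.BirchSwinnertonDyer.Rank1Residual.X11b

variable {K : Type} [Field K] [NumberField K]

/-- **Two restrictions of one `τ ∈ Γ_K` are compatible with the inclusion of levels**: if
`τ ∘ emb₁ = emb₁ ∘ σ₁` on `K[a]`, `τ ∘ emb = emb ∘ σ` on `K[b] ⊇ K[a]` and `emb ∘ incl = emb₁`, then
`σ (incl x) = incl (σ₁ x)`. [cite: GrossLMS1991, §3 (p. 238: the tower K_m ⊂ K_n)] -/
theorem apply_inclusion_eq_of_restrict (ι : K →+* ℂ) {a b : ℕ}
    (hle : ringClassField K ι a ≤ ringClassField K ι b)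
    (emb₁ : ringClassField K ι a →+* AlgebraicClosure K) (emb : ringClassField K ι b →+* AlgebraicClosure K)
    (hcoh : ∀ x : ringClassField K ι a, emb (RingClassField.inclusion ι hle x) = emb₁ x)
    {τ : absoluteGaloisGroup K} {σ₁ : ringClassField K ι a ≃ₐ[ℚ] ringClassField K ι a}
    {σ : ringClassField K ι b ≃ₐ[ℚ] ringClassField K ι b}
    (hτσ₁ : ∀ x, (show AlgebraicClosure K ≃ₐ[K] AlgebraicClosure K from τ) (emb₁ x) = emb₁ (σ₁ x)) (hτσ : ∀ x, (show AlgebraicClosure K ≃ₐ[K] AlgebraicClosure K from τ) (emb x) = emb (σ x))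
    (x : ringClassField K ι a) :
    σ (RingClassField.inclusion ι hle x) = RingClassField.inclusion ι hle (σ₁ x) := by
  apply emb.injective
  rw [← hτσ, hcoh, hcoh, hτσ₁]

/-- ★ **One inertia element generates `G_q` at every level.**  `K ∋ ω`-free form: `K` imaginary quadratic,
`q` a prime with `(q)` prime in `𝓞_K`, `v ∋ q`, `𝔓 ∣ v`, `τ ∈ I_𝔓`; a base level `qd` (`q ∤ d`,
`2 ≤ d ∨ d_K < −4`) with an embedded `K[qd]` and a generator `σ₁` of `Gal(K[qd]/K[d])` with `τ ∘ emb₁ = emb₁ ∘ σ₁`;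
a level `qm` (`q ∤ m`, `2 ≤ m ∨ d_K < −4`, `K[qd] ⊆ K[qm]`) with a COHERENT embedding `emb` and the restriction
`σ` of `τ` (`τ ∘ emb = emb ∘ σ`).  Then `⟨σ⟩ = Gal(K[qm]/K[m])`. [cite: GrossLMS1991, §3 (p. 238–240)]
[cite: McCallumLMS1991, §4 (p. 304)] [cite: Cox2013, §9.A] -/
theorem zpowers_eq_ringClassGalOver_of_mem_inertia (hK : IsImaginaryQuadratic K) (ι : K →+* ℂ)
    {q d m : ℕ} (hq : q.Prime) (hd : d ≠ 0) (hm : m ≠ 0) (hqd : ¬ q ∣ d) (hqm : ¬ q ∣ m)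
    (hunits₁ : 2 ≤ d ∨ NumberField.discr K < -4) (hunits : 2 ≤ m ∨ NumberField.discr K < -4)
    (hqP : (Ideal.span {(q : 𝓞 K)}).IsPrime) {v : HeightOneSpectrum (𝓞 K)} (hv : (q : 𝓞 K) ∈ v.asIdeal)
    {𝔓 : Ideal (absIntegers (𝓞 K) K)} (h𝔓 : 𝔓 ∈ v.primesAbove)
    {τ : absoluteGaloisGroup K} (hτ : τ ∈ 𝔓.inertia (absoluteGaloisGroup K))
    (emb₁ : ringClassField K ι (q * d) →+* AlgebraicClosure K)
    {σ₁ : ringClassField K ι (q * d) ≃ₐ[ℚ] ringClassField K ι (q * d)}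
    (hσ₁ : Subgroup.zpowers σ₁ = ringClassGalOver ι (q * d) d)
    (hτσ₁ : ∀ x, (show AlgebraicClosure K ≃ₐ[K] AlgebraicClosure K from τ) (emb₁ x) = emb₁ (σ₁ x))
    (hle : ringClassField K ι (q * d) ≤ ringClassField K ι (q * m))
    (emb : ringClassField K ι (q * m) →+* AlgebraicClosure K)
    (hemb : ∀ k : K, emb (algebraMap K (ringClassField K ι (q * m)) k) = algebraMap K (AlgebraicClosure K) k)
    (hcoh : ∀ x : ringClassField K ι (q * d), emb (RingClassField.inclusion ι hle x) = emb₁ x)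
    {σ : ringClassField K ι (q * m) ≃ₐ[ℚ] ringClassField K ι (q * m)}
    (hτσ : ∀ x, (show AlgebraicClosure K ≃ₐ[K] AlgebraicClosure K from τ) (emb x) = emb (σ x)) :
    Subgroup.zpowers σ = ringClassGalOver ι (q * m) m := by
  have hqm0 : q * m ≠ 0 := mul_ne_zero hq.ne_zero hm
  have hqd0 : q * d ≠ 0 := mul_ne_zero hq.ne_zero hd
  -- `σ ∈ G_q`: `τ` fixes `K[m]` (the layer `K[qm]/K[m]` is the only one ramified at `q`)
  have hmem : σ ∈ ringClassGalOver ι (q * m) m := by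
    refine (mem_fixingSubgroup_iff _).mpr fun x hx ↦ ?_
    change σ x = x
    apply emb.injective
    rw [← hτσ]
    exact apply_emb_eq_self_of_mem_inertia_of_mem_ringClassField hK ι hq hm hqm hv hqP emb hemb h𝔓 hτ hx
  have hle' : Subgroup.zpowers σ ≤ ringClassGalOver ι (q * m) m := (Subgroup.zpowers_le).mpr hmem
  -- `#G_q = q + 1` at the level `qm`
  have hdiv : q * m / q = m := Nat.mul_div_cancel_left m hq.pos
  have hcard : Nat.card (ringClassGalOver ι (q * m) m) = q + 1 := by
    have h := card_ringClassGalOver_div_eq_succ hK ι hq hqP (dvd_mul_right q m) (by rw [hdiv]; exact hqm)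
      hqm0 (by rw [hdiv]; exact hunits)
    rwa [hdiv] at h
  -- `orderOf σ₁ = q + 1` at the base level `qd`
  have hdiv₁ : q * d / q = d := Nat.mul_div_cancel_left d hq.pos
  have hord₁ : orderOf σ₁ = q + 1 :=
    orderOf_eq_succ_of_zpowers_eq_ringClassGalOver hK ι hq hqP (dvd_mul_right q d) (by rw [hdiv₁]; exact hqd)
      hqd0 (by rw [hdiv₁]; exact hunits₁) (by rw [hdiv₁]; exact hσ₁)
  -- `σ^k = 1 ⟹ σ₁^k = 1` through the injective inclusion
  have hpow : ∀ (k : ℕ) (x : ringClassField K ι (q * d)),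
      (σ ^ k) (RingClassField.inclusion ι hle x) = RingClassField.inclusion ι hle ((σ₁ ^ k) x) := by
    intro k
    induction k with
    | zero => intro x; rfl
    | succ k ih =>
      intro x
      rw [pow_succ, pow_succ, AlgEquiv.mul_apply, AlgEquiv.mul_apply,
        apply_inclusion_eq_of_restrict ι hle emb₁ emb hcoh hτσ₁ hτσ, ih]
  have hdvd : q + 1 ∣ orderOf σ := by
    rw [← hord₁]
    refine orderOf_dvd_of_pow_eq_one (AlgEquiv.ext fun x ↦ ?_)
    apply RingClassField.inclusion_injective ι hle
    rw [← hpow, pow_orderOf_eq_one]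
    rfl
  -- count
  haveI := (finiteDimensional_and_isGalois_ringClassField hK ι hqm0).1
  haveI : FiniteDimensional ℚ (ringClassField K ι (q * m)) := Module.Finite.trans K _
  have hfin : IsOfFinOrder σ := isOfFinOrder_of_finite σ
  haveI : Finite (ringClassGalOver ι (q * m) m) := Nat.finite_of_card_ne_zero (by rw [hcard]; omega)
  refine Subgroup.eq_of_le_of_card_ge hle' ?_
  rw [hcard, Nat.card_zpowers]
  exact Nat.le_of_dvd hfin.orderOf_pos hdvd

end Summit.BirchSwinnertonDyer.BirchSwinnertonDyer.Theorems.SylvesterTwoCMFlip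

end
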